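import Summits.AtomisticToContinuum.Crystallization.Theorems.OverbindingBudgetAffineRunCutChiralityRemainder
import Summits.AtomisticToContinuum.Crystallization.Theorems.OverbindingBudgetAffineRunCutChiralityKappa
import Summits.AtomisticToContinuum.Crystallization.Theorems.OverbindingBudgetAffineRunCutChiralitySelect
import Summits.AtomisticToContinuum.Crystallization.Theorems.OverbindingBudgetAffineRunCutChiralityCap
import Summits.AtomisticToContinuum.Crystallization.Theorems.OverbindingBudgetAffineRunCutChiralKernel
import Summits.AtomisticToContinuum.Crystallization.Theorems.OverbindingBudgetAffineRunCutChiralityKernel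
import Summits.AtomisticToContinuum.Crystallization.Theorems.OverbindingBudgetAffineRunCutChiralityDeform

/-!
# `OverbindingBudget` / crux `RobustDefectLimitWindows` (stmt-AtomisticToContinuum-31280) — «RunCut»: the CHIRALITY LINE CLOSED — the class-exchange
energy of one strained bilayer

Support file (lens-4 g87, hand-in 3; memo `g87/memo/SW-CHI.md` §3; assembles `…RunCutChiralityTaylor/Remainder/Select/Moments/Kappa/Cap`
(g86, landed) with `…RunCutChiralityKernel` (the two box-sum enclosures) and `…RunCutChiralityDeform` (the pointwise deformation
inequalities), both g87).

THE OBJECT.  A bilayer of the close packing at own scale `a` under the affine chart `1 + C` (layer frame; `C` the chart defect, Frobenius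
bound `Σ C_ij² ≤ η²`): the interlayer bonds to ONE offset coset are `r(i,j) = (x, y, h)`, `x = a(2i+j+1)/2`, `y = a(3j+1)/(2√3)`, `h = a√(2/3)`,
`|r|² = a²(Q₁(i,j) + 2/3)` (`normSq3_bond`); the bonds to the OTHER coset (the other stacking class) are the class partners `r̄ = (−x, −y, h)`.
The pair energy in the squared length is `W = ljSq` (`…RunCutForgone.lennardJones_eq_ljSq`), and the deformed squared length is `|r|² + t(r)`,
`t = strainT C` (`…RunCutChiralityDeform.normSq3_add_strainT`).  The CLASS-EXCHANGE ENERGY of the strained bilayer is therefore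
  `D(C) = Σ'_{(i,j)} [ W(|r|² + t(r)) − W(|r|² + t(r̄)) ]`.
THE THEOREM (★ `bilayer_exchange_le`, `0 < a`, `0 ≤ η ≤ 1/250`): `D(C)` is (absolutely) summable and
  `|D(C)| ≤ |κ(a)|·|F(E)| + (31/3·τ³ + 7/2·σ)·a⁻¹²·J₁⁽⁶⁾(2/3) + (7/2·τ³ + 2σ)·a⁻⁶·J₁⁽³⁾(2/3)`,  `τ = 2η + η²`, `σ = 4η³ + η⁴`,
`F(E) = (e₁₁ − e₂₂)e₂₃ + 2e₁₂e₁₃` the chirality form of the symmetric part `E` of `C`, `κ = kappaLJ` the certified coefficient of `…RunCutChiral`.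
Proof = the three-way split of the summand: the Taylor remainder (`coset_remainder_le`, fed by `abs_strainT_le` / `abs_strainT_sq_sub_le`);
the first-order part `½(P⁻⁴ − P⁻⁷)(t − t̄)`, which is LINEAR in `(x, y)` (`strainT_sub_classBar_vec3`) and vanishes by the first C₃ moments
(`odd_moments_metric`); the second-order part `(7P⁻⁸ − 4P⁻⁵)((rᵀCr)² − (r̄ᵀCr̄)²) = g_a·(…)`, which the selection rule
(`tsum_weight_quadForm_sq_sub` + the five odd moment identities) collapses to `8h(Σ' g_a x²y)·F(E) = κ(a)·F(E)` (`kappaLJ_eq_moment`).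
NUMERIC EDITION (★ `bilayer_exchange_le_milli`, the `AffFramed` scale `θ₀ = 10⁻³`, `Σ C_ij² ≤ (3/2)θ₀²` from `…RunCutChiralityCap.sum_sq_le_of_shell`):
  `|D(C)| ≤ ¾·10⁻⁶·|κ(a)| + 5.44·10⁻⁷·a⁻¹² + 2.46·10⁻⁷·a⁻⁶`, and on the TRIPLE window `a ≥ 106/125`: `|D(C)| ≤ 3.46·10⁻⁵` per exchanged bilayer
(★ `bilayer_exchange_le_window`; of which `3·10⁻⁵` is the `κ`-line already in the budget of record and `4.6·10⁻⁶` the new remainder; three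
exchanged bilayers per TRIPLE column, `…RunCutWordCount`).
[this file: 5 definitions (`cosetX`, `cosetY`, `cosetH`, `bond`, `gLJ`), 12 theorems; standard axioms]
-/

namespace Summit.AtomisticToContinuum.Crystallization.Theorems.OverbindingBudgetAffineRunCutChiralityLink

open Finset
open Literature.MathematicalPhysics.StatisticalMechanics.StackingSums
open Summit.AtomisticToContinuum.Crystallization.Theorems.OverbindingBudgetAffineRunCutForgone (ljSq)
open Summit.AtomisticToContinuum.Crystallization.Theorems.OverbindingBudgetAffineRunCutAxial
open Summit.AtomisticToContinuum.Crystallization.Theorems.OverbindingBudgetAffineRunCutChiralityMoments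
open Summit.AtomisticToContinuum.Crystallization.Theorems.OverbindingBudgetAffineRunCutChiral (kappaLJ)
open Summit.AtomisticToContinuum.Crystallization.Theorems.OverbindingBudgetAffineRunCutChiralKernel (abs_kappaLJ_le_forty)
open Summit.AtomisticToContinuum.Crystallization.Theorems.OverbindingBudgetAffineRunCutChiralityKappa
open Summit.AtomisticToContinuum.Crystallization.Theorems.OverbindingBudgetAffineRunCutChiralitySelect (tsum_weight_quadForm_sq_sub)
open Summit.AtomisticToContinuum.Crystallization.Theorems.OverbindingBudgetAffineRunCutChiralityCap (chirality_cap_of_sum_sq)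
open Summit.AtomisticToContinuum.Crystallization.Theorems.OverbindingBudgetAffineRunCutChiralityRemainder (coset_remainder_le)
open Summit.AtomisticToContinuum.Crystallization.Theorems.OverbindingBudgetAffineRunCutChiralityKernel
open Summit.AtomisticToContinuum.Crystallization.Theorems.OverbindingBudgetAffineRunCutChiralityDeform

/-! ## §1. The offset coset at own scale `a`: metric coordinates, the bond, the dictionary -/

/-- In-plane coordinate `x = a(2i + j + 1)/2` of the offset-coset point `(i, j)`. [this file · kind: definition] -/
noncomputable def cosetX (a : ℝ) (ij : ℤ × ℤ) : ℝ :=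
  a * (2 * (ij.1 : ℝ) + ij.2 + 1) / 2

/-- In-plane coordinate `y = a(3j + 1)/(2√3)` of the offset-coset point `(i, j)`. [this file · kind: definition] -/
noncomputable def cosetY (a : ℝ) (ij : ℤ × ℤ) : ℝ :=
  a * (3 * (ij.2 : ℝ) + 1) / (2 * Real.sqrt 3)

/-- The adjacent-layer height `h = a√(2/3)`. [this file · kind: definition] -/
noncomputable def cosetH (a : ℝ) : ℝ :=
  a * Real.sqrt (2 / 3)

/-- The interlayer bond `r(i, j) = (x, y, h)` to the offset-coset point `(i, j)` of the adjacent layer. [this file · kind: definition] -/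
noncomputable def bond (a : ℝ) (ij : ℤ × ℤ) : Fin 3 → ℝ :=
  ![cosetX a ij, cosetY a ij, cosetH a]

/-- The chirality weight of the offset coset, `g_a = 2W″(|r|²) = 7a⁻¹⁶(Q₁ + 2/3)⁻⁸ − 4a⁻¹⁰(Q₁ + 2/3)⁻⁵`. [this file · kind: definition] -/
noncomputable def gLJ (a : ℝ) (ij : ℤ × ℤ) : ℝ :=
  7 * (a⁻¹) ^ 16 * layerTerm 1 8 (2 / 3) ij - 4 * (a⁻¹) ^ 10 * layerTerm 1 5 (2 / 3) ij

/-- ★ **DICTIONARY**: `|r(i, j)|² = a²(Q₁(i, j) + 2/3)`. [this file · kind: proof] -/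
theorem normSq3_bond (a : ℝ) (ij : ℤ × ℤ) : normSq3 (bond a ij) = a ^ 2 * (stackForm 1 ij.1 ij.2 + 2 / 3) := by
  have h12 := twelve_stackForm_eq (δ := 1) le_rfl ij.1 ij.2
  simp only [Nat.cast_one] at h12
  have hs3 : Real.sqrt 3 ^ 2 = 3 := Real.sq_sqrt (by norm_num)
  have hs23 : Real.sqrt (2 / 3) ^ 2 = 2 / 3 := Real.sq_sqrt (by norm_num)
  rw [bond, normSq3_vec3]
  have e1 : cosetY a ij ^ 2 = a ^ 2 * (3 * (ij.2 : ℝ) + 1) ^ 2 / 12 := by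
    rw [cosetY, div_pow, mul_pow, mul_pow, hs3]; ring
  have e2 : cosetH a ^ 2 = a ^ 2 * (2 / 3) := by rw [cosetH, mul_pow, hs23]
  rw [e1, e2, cosetX]
  linear_combination (-(a ^ 2 / 12)) * h12

/-- `(a²(Q₁ + 2/3))⁻ⁿ = a⁻²ⁿ·layerTerm 1 n (2/3)`. [folklore] -/
theorem invP_pow (a : ℝ) (ij : ℤ × ℤ) (n m : ℕ) (h : m = 2 * n) :
    ((a ^ 2 * (stackForm 1 ij.1 ij.2 + 2 / 3))⁻¹) ^ n = (a⁻¹) ^ m * layerTerm 1 n (2 / 3) ij := by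
  subst h
  rw [mul_inv, mul_pow, ← inv_pow a 2, ← pow_mul]
  simp only [layerTerm]

/-! ## §2. The weight `g_a`: invariances, summable moments, the five odd identities -/

/-- `g_a` is C₃-invariant. [folklore] -/
theorem gLJ_c3Map (a : ℝ) (ij : ℤ × ℤ) : gLJ a (c3Map 1 ij) = gLJ a ij := by
  simp only [gLJ, layerTerm_c3Map]

/-- `g_a` is mirror-invariant. [folklore] -/
theorem gLJ_mirrorMap (a : ℝ) (ij : ℤ × ℤ) : gLJ a (mirrorMap 1 ij) = gLJ a ij := by
  simp only [gLJ, layerTerm_mirrorMap]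

/-- The six moment summabilities of `g_a` in integer coordinates `X = 2i+j+1`, `Y = 3j+1`. [this file · kind: proof] -/
theorem gLJ_moments_summable (a : ℝ) :
    (Summable fun ij : ℤ × ℤ => gLJ a ij * (2 * (ij.1 : ℝ) + ij.2 + 1))
      ∧ (Summable fun ij : ℤ × ℤ => gLJ a ij * (3 * (ij.2 : ℝ) + 1))
      ∧ (Summable fun ij : ℤ × ℤ => gLJ a ij * (2 * (ij.1 : ℝ) + ij.2 + 1) ^ 3)
      ∧ (Summable fun ij : ℤ × ℤ => gLJ a ij * ((2 * (ij.1 : ℝ) + ij.2 + 1) * (3 * (ij.2 : ℝ) + 1) ^ 2))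
      ∧ (Summable fun ij : ℤ × ℤ => gLJ a ij * (3 * (ij.2 : ℝ) + 1) ^ 3)
      ∧ (Summable fun ij : ℤ × ℤ => gLJ a ij * ((2 * (ij.1 : ℝ) + ij.2 + 1) ^ 2 * (3 * (ij.2 : ℝ) + 1))) := by
  have h23 : (0 : ℝ) ≤ 2 / 3 := by norm_num
  obtain ⟨a8, b8, c8, d8, e8, f8⟩ := layerTerm_moments_summable (δ := 1) le_rfl h23 (n := 8) (by norm_num)
  obtain ⟨a5, b5, c5, d5, e5, f5⟩ := layerTerm_moments_summable (δ := 1) le_rfl h23 (n := 5) (by norm_num)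
  simp only [Nat.cast_one] at a8 b8 c8 d8 e8 f8 a5 b5 c5 d5 e5 f5
  refine ⟨((a8.mul_left (7 * (a⁻¹) ^ 16)).sub (a5.mul_left (4 * (a⁻¹) ^ 10))).congr fun ij => ?_,
    ((b8.mul_left (7 * (a⁻¹) ^ 16)).sub (b5.mul_left (4 * (a⁻¹) ^ 10))).congr fun ij => ?_,
    ((c8.mul_left (7 * (a⁻¹) ^ 16)).sub (c5.mul_left (4 * (a⁻¹) ^ 10))).congr fun ij => ?_,
    ((d8.mul_left (7 * (a⁻¹) ^ 16)).sub (d5.mul_left (4 * (a⁻¹) ^ 10))).congr fun ij => ?_,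
    ((e8.mul_left (7 * (a⁻¹) ^ 16)).sub (e5.mul_left (4 * (a⁻¹) ^ 10))).congr fun ij => ?_,
    ((f8.mul_left (7 * (a⁻¹) ^ 16)).sub (f5.mul_left (4 * (a⁻¹) ^ 10))).congr fun ij => ?_⟩
  all_goals simp only [gLJ]; ring

/-- The six moment summabilities of `g_a` in the metric coordinates `(x, y)` — the hypotheses `s1x … s3yyy` of
`tsum_weight_quadForm_sq_sub`. [this file · kind: proof] -/
theorem gLJ_metric_summable (a : ℝ) :
    (Summable fun ij : ℤ × ℤ => gLJ a ij * cosetX a ij) ∧ (Summable fun ij : ℤ × ℤ => gLJ a ij * cosetY a ij)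
      ∧ (Summable fun ij : ℤ × ℤ => gLJ a ij * cosetX a ij ^ 3)
      ∧ (Summable fun ij : ℤ × ℤ => gLJ a ij * (cosetX a ij ^ 2 * cosetY a ij))
      ∧ (Summable fun ij : ℤ × ℤ => gLJ a ij * (cosetX a ij * cosetY a ij ^ 2))
      ∧ (Summable fun ij : ℤ × ℤ => gLJ a ij * cosetY a ij ^ 3) := by
  obtain ⟨t1, t2, s1, s2, s3, s4⟩ := gLJ_moments_summable a
  refine ⟨(t1.mul_left (a / 2)).congr fun ij => ?_, (t2.mul_left (a / (2 * Real.sqrt 3))).congr fun ij => ?_,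
    (s1.mul_left (a ^ 3 / 8)).congr fun ij => ?_, (s4.mul_left (a ^ 3 / (8 * Real.sqrt 3))).congr fun ij => ?_,
    (s2.mul_left (a ^ 3 / (8 * Real.sqrt 3 ^ 2))).congr fun ij => ?_,
    (s3.mul_left (a ^ 3 / (8 * Real.sqrt 3 ^ 3))).congr fun ij => ?_⟩
  all_goals simp only [cosetX, cosetY]; ring

/-- ★ **The five odd moment identities of `g_a` in metric coordinates** (`odd_moments_metric` for the C₃- and mirror-invariant `g_a`).
[this file · kind: proof] -/
theorem gLJ_odd_moments (a : ℝ) :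
    (∑' ij : ℤ × ℤ, gLJ a ij * cosetX a ij = 0) ∧ (∑' ij : ℤ × ℤ, gLJ a ij * cosetY a ij = 0)
      ∧ (∑' ij : ℤ × ℤ, gLJ a ij * cosetX a ij ^ 3 = 0)
      ∧ (∑' ij : ℤ × ℤ, gLJ a ij * (cosetX a ij * cosetY a ij ^ 2) = 0)
      ∧ (∑' ij : ℤ × ℤ, gLJ a ij * cosetY a ij ^ 3 = -∑' ij : ℤ × ℤ, gLJ a ij * (cosetX a ij ^ 2 * cosetY a ij)) := by
  obtain ⟨t1, t2, s1, s2, s3, s4⟩ := gLJ_moments_summable a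
  have H := odd_moments_metric (δ := 1) (gLJ a) (gLJ_c3Map a) (gLJ_mirrorMap a) a
    (by simpa only [Nat.cast_one] using t1) (by simpa only [Nat.cast_one] using t2) (by simpa only [Nat.cast_one] using s1)
    (by simpa only [Nat.cast_one] using s2) (by simpa only [Nat.cast_one] using s3) (by simpa only [Nat.cast_one] using s4)
  simp only [Nat.cast_one] at H
  exact H

/-- **First moments of a single layer-term weight** (`n ≥ 4`): `Σ' (Q₁+2/3)⁻ⁿ·x = Σ' (Q₁+2/3)⁻ⁿ·y = 0`, with the summabilities.
[this file · kind: proof] -/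
theorem layerTerm_first_moments (a : ℝ) {n : ℕ} (hn : 4 ≤ n) :
    (Summable fun ij : ℤ × ℤ => layerTerm 1 n (2 / 3) ij * cosetX a ij)
      ∧ (Summable fun ij : ℤ × ℤ => layerTerm 1 n (2 / 3) ij * cosetY a ij)
      ∧ (∑' ij : ℤ × ℤ, layerTerm 1 n (2 / 3) ij * cosetX a ij = 0) ∧ (∑' ij : ℤ × ℤ, layerTerm 1 n (2 / 3) ij * cosetY a ij = 0) := by
  have h23 : (0 : ℝ) ≤ 2 / 3 := by norm_num
  obtain ⟨t1, t2, s1, s2, s3, s4⟩ := layerTerm_moments_summable (δ := 1) le_rfl h23 hn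
  have H := odd_moments_metric (δ := 1) (layerTerm 1 n (2 / 3)) (layerTerm_c3Map 1 n (2 / 3)) (layerTerm_mirrorMap 1 n (2 / 3)) a
    t1 t2 s1 s2 s3 s4
  simp only [Nat.cast_one] at H t1 t2
  refine ⟨(t1.mul_left (a / 2)).congr fun ij => ?_, (t2.mul_left (a / (2 * Real.sqrt 3))).congr fun ij => ?_, H.1, H.2.1⟩
  · simp only [cosetX]; ring
  · simp only [cosetY]; ring

/-! ## §3. The second-order part: the selection rule and `κ(a)` -/

/-- ★ **SECOND ORDER = `κ(a)·F(E)`**: `Σ' g_a·[(rᵀCr)² − (r̄ᵀCr̄)²] = kappaLJ a · ((e₁₁ − e₂₂)e₂₃ + 2e₁₂e₁₃)` (symmetrised entries of `C`),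
and the summand is summable. [this file · kind: proof] -/
theorem second_order_eq {a : ℝ} (ha : a ≠ 0) (C : Matrix (Fin 3) (Fin 3) ℝ) :
    (Summable fun ij : ℤ × ℤ => gLJ a ij * (quadForm C (bond a ij) ^ 2 - quadForm C (classBar (bond a ij)) ^ 2))
      ∧ ∑' ij : ℤ × ℤ, gLJ a ij * (quadForm C (bond a ij) ^ 2 - quadForm C (classBar (bond a ij)) ^ 2)
          = kappaLJ a * ((C 0 0 - C 1 1) * ((C 1 2 + C 2 1) / 2) + 2 * (((C 0 1 + C 1 0) / 2) * ((C 0 2 + C 2 0) / 2))) := by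
  obtain ⟨s1x, s1y, s3xxx, s3xxy, s3xyy, s3yyy⟩ := gLJ_metric_summable a
  obtain ⟨m1x, m1y, m3xxx, m3xyy, m3yyy⟩ := gLJ_odd_moments a
  have e : ∀ q : ℤ × ℤ, gLJ a q * (quadForm C (bond a q) ^ 2 - quadForm C (classBar (bond a q)) ^ 2)
      = gLJ a q * ((C 0 0 * cosetX a q ^ 2 + C 1 1 * cosetY a q ^ 2 + C 2 2 * cosetH a ^ 2
            + 2 * ((C 0 1 + C 1 0) / 2) * (cosetX a q * cosetY a q) + 2 * ((C 0 2 + C 2 0) / 2) * (cosetX a q * cosetH a)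
            + 2 * ((C 1 2 + C 2 1) / 2) * (cosetY a q * cosetH a)) ^ 2
          - (C 0 0 * cosetX a q ^ 2 + C 1 1 * cosetY a q ^ 2 + C 2 2 * cosetH a ^ 2
            + 2 * ((C 0 1 + C 1 0) / 2) * (cosetX a q * cosetY a q) - 2 * ((C 0 2 + C 2 0) / 2) * (cosetX a q * cosetH a)
            - 2 * ((C 1 2 + C 2 1) / 2) * (cosetY a q * cosetH a)) ^ 2) := by
    intro q
    rw [bond, quadForm_classBar_vec3, quadForm_vec3]
  constructor
  · have expand : ∀ q : ℤ × ℤ, gLJ a q * (quadForm C (bond a q) ^ 2 - quadForm C (classBar (bond a q)) ^ 2)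
        = 8 * cosetH a * (C 0 0 * ((C 0 2 + C 2 0) / 2)) * (gLJ a q * cosetX a q ^ 3)
          + 8 * cosetH a * (C 0 0 * ((C 1 2 + C 2 1) / 2) + 2 * ((C 0 1 + C 1 0) / 2) * ((C 0 2 + C 2 0) / 2))
              * (gLJ a q * (cosetX a q ^ 2 * cosetY a q))
          + 8 * cosetH a * (C 1 1 * ((C 0 2 + C 2 0) / 2) + 2 * ((C 0 1 + C 1 0) / 2) * ((C 1 2 + C 2 1) / 2))
              * (gLJ a q * (cosetX a q * cosetY a q ^ 2))
          + 8 * cosetH a * (C 1 1 * ((C 1 2 + C 2 1) / 2)) * (gLJ a q * cosetY a q ^ 3)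
          + 8 * cosetH a ^ 3 * C 2 2 * ((C 0 2 + C 2 0) / 2) * (gLJ a q * cosetX a q)
          + 8 * cosetH a ^ 3 * C 2 2 * ((C 1 2 + C 2 1) / 2) * (gLJ a q * cosetY a q) := by
      intro q
      rw [e q]
      ring
    exact ((((((s3xxx.mul_left _).add (s3xxy.mul_left _)).add (s3xyy.mul_left _)).add (s3yyy.mul_left _)).add
      (s1x.mul_left _)).add (s1y.mul_left _)).congr fun q => (expand q).symm
  · have hsel := tsum_weight_quadForm_sq_sub (gLJ a) (cosetX a) (cosetY a) (cosetH a) (C 0 0) (C 1 1) (C 2 2)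
      ((C 0 1 + C 1 0) / 2) ((C 0 2 + C 2 0) / 2) ((C 1 2 + C 2 1) / 2) s1x s1y s3xxx s3xxy s3xyy s3yyy m1x m1y m3xxx m3xyy m3yyy
    rw [tsum_congr e, hsel, ← kappaLJ_eq_moment ha]
    simp only [gLJ, cosetX, cosetY, cosetH]

/-! ## §4. ★ The class-exchange energy of one strained bilayer -/

/-- ★ **THE CHIRALITY LINE, CLOSED.**  For `0 < a`, `0 ≤ η ≤ 1/250` and a chart defect with `Σ C_ij² ≤ η²`, the class-exchange energy
`D(C) = Σ' [W(|r|² + t(r)) − W(|r|² + t(r̄))]` of the strained bilayer is summable and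
`|D(C)| ≤ |κ(a)|·|F(E)| + (31/3·τ³ + 7/2·σ)·a⁻¹²·J₁⁽⁶⁾(2/3) + (7/2·τ³ + 2σ)·a⁻⁶·J₁⁽³⁾(2/3)`, `τ = 2η + η²`, `σ = 4η³ + η⁴`.
[this file · kind: proof] -/
theorem bilayer_exchange_le {a η : ℝ} (ha : 0 < a) (hη : 0 ≤ η) (hη1 : η ≤ 1 / 250) (C : Matrix (Fin 3) (Fin 3) ℝ)
    (hC : ∑ i, ∑ j, C i j ^ 2 ≤ η ^ 2) :
    (Summable fun ij : ℤ × ℤ =>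
        ljSq (a ^ 2 * (stackForm 1 ij.1 ij.2 + 2 / 3) + strainT C (bond a ij))
          - ljSq (a ^ 2 * (stackForm 1 ij.1 ij.2 + 2 / 3) + strainT C (classBar (bond a ij))))
      ∧ |∑' ij : ℤ × ℤ, (ljSq (a ^ 2 * (stackForm 1 ij.1 ij.2 + 2 / 3) + strainT C (bond a ij))
            - ljSq (a ^ 2 * (stackForm 1 ij.1 ij.2 + 2 / 3) + strainT C (classBar (bond a ij))))|
        ≤ |kappaLJ a| * |(C 0 0 - C 1 1) * ((C 1 2 + C 2 1) / 2) + 2 * (((C 0 1 + C 1 0) / 2) * ((C 0 2 + C 2 0) / 2))|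
          + ((31 / 3 * (2 * η + η ^ 2) ^ 3 + 7 / 2 * (4 * η ^ 3 + η ^ 4)) * (a⁻¹) ^ 12 * layerSum 1 6 (2 / 3)
            + (7 / 2 * (2 * η + η ^ 2) ^ 3 + 2 * (4 * η ^ 3 + η ^ 4)) * (a⁻¹) ^ 6 * layerSum 1 3 (2 / 3)) := by
  have hτ : 0 ≤ 2 * η + η ^ 2 := by positivity
  have hτ1 : 100 * (2 * η + η ^ 2) ≤ 1 := by nlinarith [mul_le_mul_of_nonneg_left hη1 hη]
  -- (i) the pointwise deformation inequalities (F2) on the coset, through the dictionary `|r|² = a²(Q₁+2/3)`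
  have ht : ∀ ij : ℤ × ℤ, |strainT C (bond a ij)| ≤ (2 * η + η ^ 2) * (a ^ 2 * (stackForm 1 ij.1 ij.2 + 2 / 3)) := fun ij => by
    rw [← normSq3_bond]; exact abs_strainT_le hη hC _
  have ht' : ∀ ij : ℤ × ℤ, |strainT C (classBar (bond a ij))| ≤ (2 * η + η ^ 2) * (a ^ 2 * (stackForm 1 ij.1 ij.2 + 2 / 3)) :=
    fun ij => by rw [← normSq3_bond, ← normSq3_classBar]; exact abs_strainT_le hη hC _
  have hu : ∀ ij : ℤ × ℤ, |strainT C (bond a ij) ^ 2 - 4 * quadForm C (bond a ij) ^ 2|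
      ≤ (4 * η ^ 3 + η ^ 4) * (a ^ 2 * (stackForm 1 ij.1 ij.2 + 2 / 3)) ^ 2 := fun ij => by
    rw [← normSq3_bond]; exact abs_strainT_sq_sub_le hη hC _
  have hu' : ∀ ij : ℤ × ℤ, |strainT C (classBar (bond a ij)) ^ 2 - 4 * quadForm C (classBar (bond a ij)) ^ 2|
      ≤ (4 * η ^ 3 + η ^ 4) * (a ^ 2 * (stackForm 1 ij.1 ij.2 + 2 / 3)) ^ 2 := fun ij => by
    rw [← normSq3_bond, ← normSq3_classBar]; exact abs_strainT_sq_sub_le hη hC _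
  -- (ii) the remainder, summed (34v)
  obtain ⟨hRs, hRle⟩ := coset_remainder_le ha hτ hτ1 (fun ij => strainT C (bond a ij)) (fun ij => strainT C (classBar (bond a ij)))
    (fun ij => quadForm C (bond a ij)) (fun ij => quadForm C (classBar (bond a ij))) ht ht' hu hu'
  -- (iii) the first-order part: linear in `(x, y)`, killed by the first moments
  obtain ⟨K₁, K₂, hdiff⟩ : ∃ K₁ K₂ : ℝ, ∀ ij : ℤ × ℤ,
      strainT C (bond a ij) - strainT C (classBar (bond a ij)) = cosetX a ij * K₁ + cosetY a ij * K₂ :=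
    ⟨_, _, fun ij => strainT_sub_classBar_vec3 C (cosetX a ij) (cosetY a ij) (cosetH a)⟩
  obtain ⟨s4x, s4y, m4x, m4y⟩ := layerTerm_first_moments a (n := 4) (by norm_num)
  obtain ⟨s7x, s7y, m7x, m7y⟩ := layerTerm_first_moments a (n := 7) (by norm_num)
  have hL : Summable fun ij : ℤ × ℤ =>
      1 / 2 * (a⁻¹) ^ 8 * K₁ * (layerTerm 1 4 (2 / 3) ij * cosetX a ij) + 1 / 2 * (a⁻¹) ^ 8 * K₂ * (layerTerm 1 4 (2 / 3) ij * cosetY a ij)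
        - 1 / 2 * (a⁻¹) ^ 14 * K₁ * (layerTerm 1 7 (2 / 3) ij * cosetX a ij)
        - 1 / 2 * (a⁻¹) ^ 14 * K₂ * (layerTerm 1 7 (2 / 3) ij * cosetY a ij) :=
    (((s4x.mul_left _).add (s4y.mul_left _)).sub (s7x.mul_left _)).sub (s7y.mul_left _)
  have hL0 : ∑' ij : ℤ × ℤ,
      (1 / 2 * (a⁻¹) ^ 8 * K₁ * (layerTerm 1 4 (2 / 3) ij * cosetX a ij) + 1 / 2 * (a⁻¹) ^ 8 * K₂ * (layerTerm 1 4 (2 / 3) ij * cosetY a ij)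
        - 1 / 2 * (a⁻¹) ^ 14 * K₁ * (layerTerm 1 7 (2 / 3) ij * cosetX a ij)
        - 1 / 2 * (a⁻¹) ^ 14 * K₂ * (layerTerm 1 7 (2 / 3) ij * cosetY a ij)) = 0 := by
    rw [(((s4x.mul_left _).add (s4y.mul_left _)).sub (s7x.mul_left _)).tsum_sub (s7y.mul_left _),
      ((s4x.mul_left _).add (s4y.mul_left _)).tsum_sub (s7x.mul_left _), (s4x.mul_left _).tsum_add (s4y.mul_left _),
      tsum_mul_left, tsum_mul_left, tsum_mul_left, tsum_mul_left, m4x, m4y, m7x, m7y]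
    ring
  have HL : HasSum (fun ij : ℤ × ℤ =>
      1 / 2 * (a⁻¹) ^ 8 * K₁ * (layerTerm 1 4 (2 / 3) ij * cosetX a ij) + 1 / 2 * (a⁻¹) ^ 8 * K₂ * (layerTerm 1 4 (2 / 3) ij * cosetY a ij)
        - 1 / 2 * (a⁻¹) ^ 14 * K₁ * (layerTerm 1 7 (2 / 3) ij * cosetX a ij)
        - 1 / 2 * (a⁻¹) ^ 14 * K₂ * (layerTerm 1 7 (2 / 3) ij * cosetY a ij)) 0 := by
    rw [← hL0]; exact hL.hasSum
  -- (iv) the second-order part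
  obtain ⟨hMs, hMeq⟩ := second_order_eq ha.ne' C
  have HM : HasSum (fun ij : ℤ × ℤ => gLJ a ij * (quadForm C (bond a ij) ^ 2 - quadForm C (classBar (bond a ij)) ^ 2))
      (kappaLJ a * ((C 0 0 - C 1 1) * ((C 1 2 + C 2 1) / 2) + 2 * (((C 0 1 + C 1 0) / 2) * ((C 0 2 + C 2 0) / 2)))) := by
    rw [← hMeq]; exact hMs.hasSum
  -- (v) the pointwise three-way split of the summand
  have e4 := fun ij : ℤ × ℤ => invP_pow a ij 4 8 rfl
  have e5 := fun ij : ℤ × ℤ => invP_pow a ij 5 10 rfl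
  have e7 := fun ij : ℤ × ℤ => invP_pow a ij 7 14 rfl
  have e8 := fun ij : ℤ × ℤ => invP_pow a ij 8 16 rfl
  have key : ∀ ij : ℤ × ℤ,
      ljSq (a ^ 2 * (stackForm 1 ij.1 ij.2 + 2 / 3) + strainT C (bond a ij))
          - ljSq (a ^ 2 * (stackForm 1 ij.1 ij.2 + 2 / 3) + strainT C (classBar (bond a ij)))
        = (ljSq (a ^ 2 * (stackForm 1 ij.1 ij.2 + 2 / 3) + strainT C (bond a ij))
              - ljSq (a ^ 2 * (stackForm 1 ij.1 ij.2 + 2 / 3) + strainT C (classBar (bond a ij)))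
            - 1 / 2 * (((a ^ 2 * (stackForm 1 ij.1 ij.2 + 2 / 3))⁻¹) ^ 4 - ((a ^ 2 * (stackForm 1 ij.1 ij.2 + 2 / 3))⁻¹) ^ 7)
              * (strainT C (bond a ij) - strainT C (classBar (bond a ij)))
            - (7 * ((a ^ 2 * (stackForm 1 ij.1 ij.2 + 2 / 3))⁻¹) ^ 8 - 4 * ((a ^ 2 * (stackForm 1 ij.1 ij.2 + 2 / 3))⁻¹) ^ 5)
              * (quadForm C (bond a ij) ^ 2 - quadForm C (classBar (bond a ij)) ^ 2))
          + (1 / 2 * (a⁻¹) ^ 8 * K₁ * (layerTerm 1 4 (2 / 3) ij * cosetX a ij)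
              + 1 / 2 * (a⁻¹) ^ 8 * K₂ * (layerTerm 1 4 (2 / 3) ij * cosetY a ij)
              - 1 / 2 * (a⁻¹) ^ 14 * K₁ * (layerTerm 1 7 (2 / 3) ij * cosetX a ij)
              - 1 / 2 * (a⁻¹) ^ 14 * K₂ * (layerTerm 1 7 (2 / 3) ij * cosetY a ij))
          + gLJ a ij * (quadForm C (bond a ij) ^ 2 - quadForm C (classBar (bond a ij)) ^ 2) := by
    intro ij
    simp only [gLJ]
    rw [hdiff ij, e4 ij, e5 ij, e7 ij, e8 ij]
    ring
  have HS := ((hRs.hasSum.add HL).add HM).congr_fun key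
  refine ⟨HS.summable, ?_⟩
  rw [HS.tsum_eq, add_zero]
  refine (abs_add_le _ _).trans ?_
  rw [abs_mul]
  linarith [hRle]

/-! ## §5. The numeric editions at the `AffFramed` scale `θ₀ = 10⁻³` -/

/-- ★ **`θ₀ = 10⁻³` edition** (`Σ C_ij² ≤ (3/2)θ₀²`, the second-shell moment bound of `…RunCutChiralityCap`): per exchanged bilayer
`|D(C)| ≤ ¾·10⁻⁶·|κ(a)| + 5.44·10⁻⁷·a⁻¹² + 2.46·10⁻⁷·a⁻⁶` (`η = 49/40000 ≥ √(3/2)·10⁻³`; cap `|F(E)| ≤ ¾θ₀²`; enclosures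
`J₁⁽⁶⁾ ≤ 3.0557`, `J₁⁽³⁾ ≤ 3.7033`). [this file · kind: proof] -/
theorem bilayer_exchange_le_milli {a : ℝ} (ha : 0 < a) (C : Matrix (Fin 3) (Fin 3) ℝ)
    (hC : ∑ i, ∑ j, C i j ^ 2 ≤ 3 / 2 * (1 / 1000) ^ 2) :
    (Summable fun ij : ℤ × ℤ =>
        ljSq (a ^ 2 * (stackForm 1 ij.1 ij.2 + 2 / 3) + strainT C (bond a ij))
          - ljSq (a ^ 2 * (stackForm 1 ij.1 ij.2 + 2 / 3) + strainT C (classBar (bond a ij))))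
      ∧ |∑' ij : ℤ × ℤ, (ljSq (a ^ 2 * (stackForm 1 ij.1 ij.2 + 2 / 3) + strainT C (bond a ij))
            - ljSq (a ^ 2 * (stackForm 1 ij.1 ij.2 + 2 / 3) + strainT C (classBar (bond a ij))))|
        ≤ 3 / 4 * (1 / 1000) ^ 2 * |kappaLJ a| + 544 / 10 ^ 9 * (a⁻¹) ^ 12 + 246 / 10 ^ 9 * (a⁻¹) ^ 6 := by
  have hC' : ∑ i, ∑ j, C i j ^ 2 ≤ (49 / 40000 : ℝ) ^ 2 := hC.trans (by norm_num)
  obtain ⟨hs, hle⟩ := bilayer_exchange_le ha (by norm_num) (by norm_num) C hC'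
  refine ⟨hs, hle.trans ?_⟩
  have hF := chirality_cap_of_sum_sq C hC
  have hk := abs_nonneg (kappaLJ a)
  have hA : 0 ≤ (a⁻¹) ^ 12 := by positivity
  have hB : 0 ≤ (a⁻¹) ^ 6 := by positivity
  have h6 := layerSum_one_six_mem.2
  have h3 := layerSum_one_three_mem.2
  have c6 : (31 / 3 * (2 * (49 / 40000 : ℝ) + (49 / 40000) ^ 2) ^ 3 + 7 / 2 * (4 * (49 / 40000) ^ 3 + (49 / 40000) ^ 4))
      * layerSum 1 6 (2 / 3) ≤ 544 / 10 ^ 9 := by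
    nlinarith
  have c3 : (7 / 2 * (2 * (49 / 40000 : ℝ) + (49 / 40000) ^ 2) ^ 3 + 2 * (4 * (49 / 40000) ^ 3 + (49 / 40000) ^ 4))
      * layerSum 1 3 (2 / 3) ≤ 246 / 10 ^ 9 := by
    nlinarith
  nlinarith [mul_le_mul_of_nonneg_left hF hk, mul_le_mul_of_nonneg_right c6 hA, mul_le_mul_of_nonneg_right c3 hB]

/-- ★ **On the TRIPLE window `a ≥ 106/125`** (`|κ(a)| ≤ 40`, `…RunCutChiralKernel.abs_kappaLJ_le_forty`): per exchanged bilayer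
`|D(C)| ≤ 3·10⁻⁵ + 4.6·10⁻⁶ = 3.46·10⁻⁵`. [this file · kind: proof] -/
theorem bilayer_exchange_le_window {a : ℝ} (ha : 106 / 125 ≤ a) (C : Matrix (Fin 3) (Fin 3) ℝ)
    (hC : ∑ i, ∑ j, C i j ^ 2 ≤ 3 / 2 * (1 / 1000) ^ 2) :
    |∑' ij : ℤ × ℤ, (ljSq (a ^ 2 * (stackForm 1 ij.1 ij.2 + 2 / 3) + strainT C (bond a ij))
        - ljSq (a ^ 2 * (stackForm 1 ij.1 ij.2 + 2 / 3) + strainT C (classBar (bond a ij))))|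
      ≤ 3 / 100000 + 46 / 10 ^ 7 := by
  have ha0 : 0 < a := by linarith
  have hle := (bilayer_exchange_le_milli ha0 C hC).2
  have hk := abs_kappaLJ_le_forty ha
  have hi : a⁻¹ ≤ 125 / 106 := by rw [inv_le_comm₀ ha0 (by norm_num)]; norm_num; exact ha
  have hi0 : 0 ≤ a⁻¹ := by positivity
  have h12 : (a⁻¹) ^ 12 ≤ (125 / 106) ^ 12 := pow_le_pow_left₀ hi0 hi 12
  have h6 : (a⁻¹) ^ 6 ≤ (125 / 106) ^ 6 := pow_le_pow_left₀ hi0 hi 6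
  nlinarith

end Summit.AtomisticToContinuum.Crystallization.Theorems.OverbindingBudgetAffineRunCutChiralityLink
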